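import Summits.AnomalousDissipation.AnomalousDissipation.Theses.TwoAndHalfD
import Literature.Analysis.FluidPDE.TwoHalfNavierStokes
import Literature.Analysis.FluidPDE.TwoHalfSection
import Literature.Analysis.FluidPDE.LongTimeAverageNonneg
import Summits.AnomalousDissipation.AnomalousDissipation.Theorems.TwoAndHalfDTwohalfdNegPlanarNoAnomaly
import Summits.AnomalousDissipation.AnomalousDissipation.Theorems.TwoAndHalfDTwohalfdNegReleaseLogBound
import Summits.AnomalousDissipation.AnomalousDissipation.Theorems.TwoAndHalfDTwohalfdNegReductionOffZero
import Summits.AnomalousDissipation.AnomalousDissipation.Theorems.TwoAndHalfDTwohalfdNegQuietOfSubLogGrid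
import Summits.AnomalousDissipation.AnomalousDissipation.Theorems.TwoAndHalfDTwohalfdNegAgeDecouplingGrid
import Summits.AnomalousDissipation.AnomalousDissipation.Theorems.TwoAndHalfDTwohalfdNegSubLogStrainSingleShell

/-!
# The transfer certificate of the line `log-kantorovich-enstrophy-transfer` for the crux
# `TwoAndHalfD.TwohalfdNeg` (stmt-AnomalousDissipation-0211), and the single-shell sub-case

Two sorry-free by-products of the checked skeleton
`Cruxes/TwohalfdNeg/Lines/log_kantorovich_enstrophy_transfer.lean` once the stubs S1'
(`ReductionOffZero`, p105427), S2 (`PlanarNoAnomaly`, p86145), S3' (`AgeDecouplingGrid`,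
p119913), S4 (`ReleaseLogBound`, p94753), S5' (`QuietOfSubLogGrid`, p95437) and S6-mono
(`SubLogStrainSingleShell`, p115114) are landed theorems:

* `twohalfdNeg_of_subLogStrain` — **the crux is transferred to two-dimensional Navier–Stokes**:
  the purely planar growth law `SubLogStrain` (for every steady smooth divergence-free mean-zero
  `g` on `T²`, every `ν_j → 0` and every bounded-mean-energy family of global Leray–Hopf
  solutions `v_j` forced by `g`, `⟨‖∇v_j‖_{L²}⟩ / log(1/ν_j) → 0`) IMPLIES `TwohalfdNeg`
  (no zeroth law in the `x₃`-invariant class). Composition: split the `x₃`-invariant family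
  (S1'); the planar dissipation tends to `0` (S2, Alexakis–Doering); sub-log strain makes the
  releases of the source profile finite-window quiet (S5' fed with the log-Kantorovich engine
  S4), so the sourced scalar's dissipation tends to `0` (S3', grid age decoupling); squeeze.
* `twohalfdNeg_twoHalf_singleShell` — **the single-shell sub-case of the crux, unconditionally**:
  for a planar force `g` with Fourier support on ONE shell `|k|² = m` (any shell, any `m ∈ ℝ`)
  and ANY smooth mean-zero source `h`, every bounded-energy family of `x₃`-invariant global
  Leray–Hopf solutions of NS_{ν_j} forced by `twoHalf g h`, `ν_j → 0`, from arbitrary `L²` data,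
  has `meanDissipation → 0` (S6-mono, Tran–Shepherd's dynamical constraint in the mean, replaces
  `SubLogStrain`). This is the theorem form of the audited claim "no zeroth law in the
  `x₃`-invariant class whenever the planar force is single-shell" (barrier docstring of
  `Literature.Barriers.AnomalousDissipation.Marchioro1986_globalAttraction`, audit generation 6,
  evidence SINGLE_SHELL_2HALFD.md / E1SUBCASE_0211.md on the item).

The file closes with the registered tools stub `stub_lineCertificate` (conjunction of the two).
Supports stmt-AnomalousDissipation-0211; the residual of the crux on this line is exactly the
hypothesis of `twohalfdNeg_of_subLogStrain` (registered stub `stub_subLogStrain`).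
-/

namespace Summit.AnomalousDissipation.AnomalousDissipation.Theorems.TwohalfdNeg.Certificate

open MeasureTheory Filter Topology
open scoped ENNReal NNReal
open Literature.Analysis.FunctionSpaces Literature.Analysis.FluidPDE
open Summit.AnomalousDissipation.AnomalousDissipation.Theorems.TwohalfdNeg

set_option linter.dupNamespace false

/-- **Transfer certificate: `SubLogStrain → TwohalfdNeg`.** If every bounded-mean-energy family
of global Leray–Hopf solutions of the steadily forced two-dimensional Navier–Stokes equations
(one fixed smooth divergence-free mean-zero force `g`, `ν_j → 0`, arbitrary `L²` data) has
sub-logarithmic `limsup`-mean strain, `⟨‖∇v_j‖_{L²}⟩ / log(1/ν_j) → 0`, then the crux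
`TwoAndHalfD.TwohalfdNeg` holds: every bounded-energy `x₃`-invariant global Leray–Hopf family
under an `x₃`-invariant steady smooth force has `meanDissipation → 0`. Kernel-checked
composition of the landed stubs S1', S2, S3', S4, S5' of the line
`log-kantorovich-enstrophy-transfer`. -/
theorem twohalfdNeg_of_subLogStrain
    (hS6 : ∀ g : UnitAddTorus (Fin 2) → EuclideanSpace ℝ (Fin 2),
      Torus.IsSmooth g → Torus.IsDivFree g → Torus.HasZeroMean g →
      ∀ (ν : ℕ → ℝ) (v₀ : ℕ → UnitAddTorus (Fin 2) → EuclideanSpace ℝ (Fin 2))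
        (v : ℕ → ℝ → UnitAddTorus (Fin 2) → EuclideanSpace ℝ (Fin 2)),
        (∀ j, 0 < ν j) → Tendsto ν atTop (𝓝 0) →
        (∀ j, Torus.IsGlobalLerayHopf (ν j) (fun _ => g) (v₀ j) (v j)) →
        (∃ E : ℝ, ∀ j, meanEnergy (v j) ≤ E) →
        Tendsto (fun j => longTimeAvgSup (fun t => Real.sqrt (Torus.eGradNormSq (v j t)).toReal) /
          Real.log (ν j)⁻¹) atTop (𝓝 0)) :
    Summit.AnomalousDissipation.AnomalousDissipation.Theses.TwoAndHalfD.TwohalfdNeg := by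
  intro f hfinv hfs hfd hfz ν u₀ u hν hν0 hLH huinv hE
  obtain ⟨g, h, v₀, v, θ₀, θ, hgs, hgd, hgz, hhs, hhz, -, -, hvLH, hθ₀, hθw, hEv, hEθ, hsplit⟩ :=
    ReductionOffZero.stub_reductionOffZero f hfinv hfs hfd hfz ν u₀ u hν hLH huinv hE
  have hplanar : Tendsto (fun j => meanDissipation (ν j) (v j)) atTop (𝓝 0) :=
    PlanarNoAnomaly.stub_planarNoAnomaly g hgs hgd hgz ν v₀ v hν hν0 hvLH hEv
  have hsub := hS6 g hgs hgd hgz ν v₀ v hν hν0 hvLH hEv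
  have hquiet := QuietOfSubLogGrid.stub_quietOfSubLogGrid
    (ReleaseLogBound.stub_releaseLogBound (d := Fin 2)) g hgs hgd hgz ν v₀ v hν hν0 hvLH hEv hsub h hhs hhz
  have hscalar : Tendsto (fun j => longTimeAvgSup
      (fun t => ν j * (Torus.eScalarGradNormSq (θ j t)).toReal)) atTop (𝓝 0) :=
    AgeDecouplingGrid.stub_ageDecouplingGrid g h hgs hgd hgz hhs hhz ν v₀ v θ₀ θ hν hvLH hEv hθ₀ hθw
      hEθ hquiet
  have hsum : Tendsto (fun j => meanDissipation (ν j) (v j) +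
      longTimeAvgSup (fun t => ν j * (Torus.eScalarGradNormSq (θ j t)).toReal)) atTop (𝓝 0) := by
    simpa using hplanar.add hscalar
  exact squeeze_zero (fun j => meanDissipation_nonneg (hν j).le (u j)) hsplit hsum

/-- **The single-shell sub-case of the crux (unconditional).** For a planar force `g` on `T²`
(smooth, divergence free, mean zero) whose Fourier coefficients live on ONE shell `|k|² = m`
(`m ∈ ℝ` arbitrary) and any smooth mean-zero source `h`, every family of `x₃`-invariant global
Leray–Hopf solutions of NS_{ν_j} on `T³` forced by the `x₃`-invariant steady field
`twoHalf g h = (g, h) ∘ π`, with `ν_j → 0`, arbitrary `L²` data and `ν`-uniformly bounded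
`limsup`-mean energy, has `meanDissipation (ν j) (u j) → 0`: no zeroth law in the
`x₃`-invariant class under single-shell planar forcing, whatever the shell, the source and the
data. Same composition as `twohalfdNeg_of_subLogStrain`, with the monoscale law
`SubLogStrainSingleShell.stub_subLogStrain_singleShell` (Tran–Shepherd's dynamical constraint
`⟨‖∇v‖²⟩ ≤ 4π² max(m,0) ⟨‖v‖²⟩` in the mean, all `L²` data) in place of the hypothesis; the
planar force returned by the reduction S1' is `g` itself (`Torus.twoHalf_left_injective`). -/
theorem twohalfdNeg_twoHalf_singleShell :
    ∀ (g : UnitAddTorus (Fin 2) → EuclideanSpace ℝ (Fin 2)) (h : UnitAddTorus (Fin 2) → ℝ),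
      Torus.IsSmooth g → Torus.IsDivFree g → Torus.HasZeroMean g →
      Torus.IsSmooth h → Torus.HasZeroMean h →
      (∃ m : ℝ, ∀ k : Fin 2 → ℤ, Torus.freqNormSq k ≠ m →
        UnitAddTorus.mFourierCoeff (EuclideanSpace.complexify ∘ g) k = 0) →
      ∀ (ν : ℕ → ℝ) (u₀ : ℕ → UnitAddTorus (Fin 3) → EuclideanSpace ℝ (Fin 3))
        (u : ℕ → ℝ → UnitAddTorus (Fin 3) → EuclideanSpace ℝ (Fin 3)),
        (∀ j, 0 < ν j) → Tendsto ν atTop (𝓝 0) →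
        (∀ j, Torus.IsGlobalLerayHopf (ν j) (fun _ => Torus.twoHalf g h) (u₀ j) (u j)) →
        (∀ j (t : ℝ) (s : UnitAddCircle) (x : UnitAddTorus (Fin 3)),
          u j t (x + Pi.single (2 : Fin 3) s) = u j t x) →
        (∃ E : ℝ, ∀ j, meanEnergy (u j) ≤ E) →
        Tendsto (fun j => meanDissipation (ν j) (u j)) atTop (𝓝 0) := by
  intro g h hgs hgd hgz hhs hhz hshell ν u₀ u hν hν0 hLH huinv hE
  have hfinv : ∀ (s : UnitAddCircle) (x : UnitAddTorus (Fin 3)),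
      Torus.twoHalf g h (x + Pi.single (2 : Fin 3) s) = Torus.twoHalf g h x := by
    intro s x
    rw [Torus.twoHalf_eq_comp, Function.comp_apply, Function.comp_apply]
    exact Torus.comp_planarProj_add_single (fun y => Torus.planarEmbed (g y, h y)) s x
  have hfs : Torus.IsSmooth (Torus.twoHalf g h) := hgs.twoHalf hhs
  have hfd : Torus.IsDivFree (Torus.twoHalf g h) := Torus.IsDivFree.twoHalf hgd h
  have hfz : Torus.HasZeroMean (Torus.twoHalf g h) :=
    Torus.hasZeroMean_twoHalf hgs.continuous.integrable_unitAddTorus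
      hhs.continuous.integrable_unitAddTorus hgz hhz
  obtain ⟨g', h', v₀, v, θ₀, θ, hgs', hgd', hgz', hhs', hhz', hfeq, -, hvLH, hθ₀, hθw, hEv, hEθ, hsplit⟩ :=
    ReductionOffZero.stub_reductionOffZero (Torus.twoHalf g h) hfinv hfs hfd hfz ν u₀ u hν hLH huinv hE
  obtain rfl : g = g' := Literature.Analysis.FluidPDE.Torus.twoHalf_left_injective hfeq
  obtain rfl : h = h' := Literature.Analysis.FluidPDE.Torus.twoHalf_right_injective hfeq
  have hplanar : Tendsto (fun j => meanDissipation (ν j) (v j)) atTop (𝓝 0) :=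
    PlanarNoAnomaly.stub_planarNoAnomaly g hgs hgd hgz ν v₀ v hν hν0 hvLH hEv
  have hsub := SubLogStrainSingleShell.stub_subLogStrain_singleShell g hgs hgd hgz hshell ν v₀ v hν hν0
    hvLH hEv
  have hquiet := QuietOfSubLogGrid.stub_quietOfSubLogGrid
    (ReleaseLogBound.stub_releaseLogBound (d := Fin 2)) g hgs hgd hgz ν v₀ v hν hν0 hvLH hEv hsub h hhs hhz
  have hscalar : Tendsto (fun j => longTimeAvgSup
      (fun t => ν j * (Torus.eScalarGradNormSq (θ j t)).toReal)) atTop (𝓝 0) :=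
    AgeDecouplingGrid.stub_ageDecouplingGrid g h hgs hgd hgz hhs hhz ν v₀ v θ₀ θ hν hvLH hEv hθ₀ hθw
      hEθ hquiet
  have hsum : Tendsto (fun j => meanDissipation (ν j) (v j) +
      longTimeAvgSup (fun t => ν j * (Torus.eScalarGradNormSq (θ j t)).toReal)) atTop (𝓝 0) := by
    simpa using hplanar.add hscalar
  exact squeeze_zero (fun j => meanDissipation_nonneg (hν j).le (u j)) hsplit hsum

/-- **Registered tools stub `stub_lineCertificate`** (conjunction of the two theorems of this
file, registered on stmt-AnomalousDissipation-0211 with `ledger workitem stub-add`): the transfer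
certificate `SubLogStrain → TwohalfdNeg` and the unconditional single-shell sub-case. -/
theorem stub_lineCertificate :
    ((∀ g : UnitAddTorus (Fin 2) → EuclideanSpace ℝ (Fin 2),
      Torus.IsSmooth g → Torus.IsDivFree g → Torus.HasZeroMean g →
      ∀ (ν : ℕ → ℝ) (v₀ : ℕ → UnitAddTorus (Fin 2) → EuclideanSpace ℝ (Fin 2))
        (v : ℕ → ℝ → UnitAddTorus (Fin 2) → EuclideanSpace ℝ (Fin 2)),
        (∀ j, 0 < ν j) → Tendsto ν atTop (𝓝 0) →
        (∀ j, Torus.IsGlobalLerayHopf (ν j) (fun _ => g) (v₀ j) (v j)) →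
        (∃ E : ℝ, ∀ j, meanEnergy (v j) ≤ E) →
        Tendsto (fun j => longTimeAvgSup (fun t => Real.sqrt (Torus.eGradNormSq (v j t)).toReal) /
          Real.log (ν j)⁻¹) atTop (𝓝 0)) →
      Summit.AnomalousDissipation.AnomalousDissipation.Theses.TwoAndHalfD.TwohalfdNeg) ∧
    (∀ (g : UnitAddTorus (Fin 2) → EuclideanSpace ℝ (Fin 2)) (h : UnitAddTorus (Fin 2) → ℝ),
      Torus.IsSmooth g → Torus.IsDivFree g → Torus.HasZeroMean g →
      Torus.IsSmooth h → Torus.HasZeroMean h →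
      (∃ m : ℝ, ∀ k : Fin 2 → ℤ, Torus.freqNormSq k ≠ m →
        UnitAddTorus.mFourierCoeff (EuclideanSpace.complexify ∘ g) k = 0) →
      ∀ (ν : ℕ → ℝ) (u₀ : ℕ → UnitAddTorus (Fin 3) → EuclideanSpace ℝ (Fin 3))
        (u : ℕ → ℝ → UnitAddTorus (Fin 3) → EuclideanSpace ℝ (Fin 3)),
        (∀ j, 0 < ν j) → Tendsto ν atTop (𝓝 0) →
        (∀ j, Torus.IsGlobalLerayHopf (ν j) (fun _ => Torus.twoHalf g h) (u₀ j) (u j)) →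
        (∀ j (t : ℝ) (s : UnitAddCircle) (x : UnitAddTorus (Fin 3)),
          u j t (x + Pi.single (2 : Fin 3) s) = u j t x) →
        (∃ E : ℝ, ∀ j, meanEnergy (u j) ≤ E) →
        Tendsto (fun j => meanDissipation (ν j) (u j)) atTop (𝓝 0)) :=
  ⟨twohalfdNeg_of_subLogStrain, twohalfdNeg_twoHalf_singleShell⟩

end Summit.AnomalousDissipation.AnomalousDissipation.Theorems.TwohalfdNeg.Certificate
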